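import Literature.Analysis.FluidPDE.HomogeneousEuler
import Mathlib.MeasureTheory.Integral.CurveIntegral.Poincare
import Mathlib.Analysis.Calculus.LineDeriv.IntegrationByParts
import Mathlib.Analysis.Calculus.BumpFunction.InnerProduct
import Mathlib.Analysis.InnerProductSpace.Calculus
import Mathlib.MeasureTheory.Measure.Haar.OfBasis
import HarnessLib

/-!
# Proof of Shvydkoy 2018, Proposition 2.1: no `C¹` homogeneous Euler flows at the Landau scaling

This file discharges the named fact
`Literature.Analysis.FluidPDE.shvydkoy_homogeneousSteadyEuler_alpha_one` of
`Literature/Analysis/FluidPDE/HomogeneousEuler.lean` by proving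
`Literature.Analysis.FluidPDE.shvydkoy_homogeneousSteadyEuler_alpha_one_holds`.

Source: R. Shvydkoy, *Homogeneous solutions to the 3D Euler system*, Trans. Amer. Math. Soc.
370 (2018) 2517–2535 = arXiv:1510.03378 [`Shvydkoy2018`], Proposition 2.1 (p. 2521 = arXiv
p. 5): "There are no `C¹`-solutions to the system (6) for `α = 1`."

## The printed proof and its bulk translation

Printed proof. At `α = 1` the reduced system on `S²` reads `f + div v = 0`, `v∇f = H`,
`v∇H = 2fH`, where `H = |v|² + f² + 2p` is the spherical Bernoulli function. (1) Testing the last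
equation with `f` and integrating by parts on `S²` twice gives `-∫ H² dσ = ⅓ ∫ f⁴ dσ`, so
`H = f = 0`. (2) The momentum equation then reads `ω v^⊥ = 0`, so `dv = 0` on `{v ≠ 0}`, hence on
its closure, and trivially on the open complement: `dv = 0` throughout, and `δv = -f = 0`. (3) A
harmonic `1`-form on `S²` vanishes (`H¹_dR(S²) = 0`), so `v = 0`.

Mathlib (at this pin) has no calculus of tangent fields on `S²` and no Hodge theory, so the same
three steps are run in bulk variables on `E ∖ {0}` (`E` a real inner product space of dimension
`3`), sphere integrals `∫_{S²} g dσ` being replaced by bulk integrals against a smooth RADIAL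
cutoff `ψ(x) = χ(‖x‖²)` supported in a shell (`Shvydkoy2018.exists_radial_cutoff`).

* Dictionary (all quantities are written out inline; no auxiliary definitions):
  `F(x) = ⟪V x, x⟫ ↔ f`, `Q = ‖V‖² + 2P`, `B = ‖x‖² Q ↔ H`, `T = V - (F/‖x‖²) x ↔ v/|x|`. The
  reduced system at `α = 1` becomes `V·∇F = Q`, `V·∇B = 2FQ`, `div T = -F/‖x‖²`
  (`Shvydkoy2018.fderiv_normalPart_velocity`, `….fderiv_sphBernoulli_velocity`,
  `….divergence_tangentialPart`; the last is where `dim E = 3` enters, through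
  `div (x/‖x‖²) = (n - 2)/‖x‖²`), with the homogeneity relations `x·∇F = x·∇B = 0`.
* Step 1 (`Shvydkoy2018.integral_identity`, `….normalPart_eq_zero_and_sphBernoulli_eq_zero`):
  one integration by parts `∫ (DG·W + G div W) = 0`
  (`Shvydkoy2018.integral_fderiv_apply_add_mul_divergence_eq_zero`, from Mathlib's coordinatewise
  `integral_bilinear_hasFDerivAt_right_eq_neg_left_of_integrable`) with `W = ψ T` (note
  `T·∇ψ = 0`) and `G = F B - F³/3` is the sum of the paper's two integrations by parts and yields
  `∫ ψ (B² + F⁴/3)/‖x‖² = 0`; continuity and `0`-homogeneity give `F ≡ B ≡ 0`.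
* Step 2 (`Shvydkoy2018.fderiv_velocity_symmetric`): with `F ≡ Q ≡ 0`, the skew part of `DV(x)`
  kills `V x` (momentum equation and `∇Q = 0`) and `x` (Euler's relation and `∇F = 0`); in
  dimension `3` a skew form vanishing on the plane spanned by `V x ⊥ x` vanishes
  (`Shvydkoy2018.inner_symm_of_pair`) — this is `ω = 0` on `{v ≠ 0}`; the paper's closure
  argument is the continuity argument of `fderiv_velocity_symmetric`. So `curl V = 0` off `0`.
* Step 3 (`Shvydkoy2018.exists_primitive_velocity`, `….integral_cutoff_mul_norm_sq`,
  `….velocity_eq_zero`): `H¹_dR(S²) = 0` is realised concretely — the closed `1`-form `⟪V, ·⟫`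
  has a primitive on each of four convex "tetrahedral" half-spaces covering `E ∖ {0}` (Mathlib's
  Poincaré lemma `Convex.exists_forall_hasFDerivAt_of_fderiv_symmetric`), and the local
  primitives glue because one chart meets all pairwise intersections of the others
  (`Shvydkoy2018.exists_primitive_of_cover`, the Čech cocycle argument). With `V = ∇Φ`,
  `div V = 0` and `V ⊥ x`: `∫ ψ ‖V‖² = ∫ ψ ⟪∇Φ, V⟫ = -∫ Φ div (ψ V) = 0`, so `V = 0` on a sphere
  and everywhere by homogeneity — the energy argument that a harmonic function on `S²` is
  constant.

## Design notes

* Everything up to the last theorem is stated for a finite-dimensional real inner product space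
  `E` (with `finrank ℝ E = 3` where needed) and an arbitrary additive Haar measure; the measurable
  structure is introduced inside the proofs (`borel E`), so the concluding statements carry no
  measure-theoretic hypotheses, and the fact on `EuclideanSpace ℝ (Fin 3)` follows from
  `finrank_euclideanSpace_fin`.
* The file introduces no definitions and no named facts: the cutoff and the tetrahedral cover
  are packaged as existence theorems (`exists_radial_cutoff`, `exists_tetrahedral_cover`), and the
  avatars `F, Q, B, T` appear as explicit lambda terms in the statements of the lemmas (namespace
  `Shvydkoy2018`).

## References

* R. Shvydkoy, *Homogeneous solutions to the 3D Euler system*, Trans. Amer. Math. Soc. 370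
  (2018), 2517–2535, doi:10.1090/tran/7022 = arXiv:1510.03378; Prop. 2.1 and its proof
  (p. 2521), §2 (the Bernoulli function `H`), Appendix. [`Shvydkoy2018`]
* L. C. Evans, *Partial Differential Equations*, 2nd ed., AMS 2010, App. C.2 (Gauss–Green).
-/

noncomputable section

open Set Filter MeasureTheory Module
open scoped InnerProductSpace RealInnerProductSpace Topology

namespace Literature.Analysis.FluidPDE

/-! ### Bulk avatars of Shvydkoy's spherical quantities and their calculus -/

namespace Shvydkoy2018

variable {E : Type*} [NormedAddCommGroup E] [InnerProductSpace ℝ E] [FiniteDimensional ℝ E]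

/-!
Dictionary (bulk avatars of Shvydkoy's spherical quantities; all inlined, no definitions):
`F(x) = ⟪V x, x⟫` (normal component `f`), `Q(x) = ‖V x‖² + 2 P(x)` (twice the Bernoulli
function), `B(x) = ‖x‖² Q(x)` (spherical Bernoulli function `H`), `k(x) = F(x)/‖x‖²`,
`T(x) = V x - k(x) x` (tangential component `v/|x|`). [cite: Shvydkoy2018, eq. (2) and §2]
-/

variable {V : E → E} {P : E → ℝ} {x : E}

omit [FiniteDimensional ℝ E] in
/-- Derivative of `F = ⟪V, x⟫`: `DF(x) w = ⟪V x, w⟫ + ⟪x, DV(x) w⟫`. [folklore] -/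
theorem hasFDerivAt_normalPart (hV : DifferentiableAt ℝ V x) :
    HasFDerivAt (fun y => ⟪V y, y⟫) (innerSL ℝ (V x) + (innerSL ℝ x).comp (fderiv ℝ V x)) x := by
  have h : HasFDerivAt (fun y => ⟪V y, y⟫) _ x := hV.hasFDerivAt.inner ℝ (hasFDerivAt_id x)
  refine h.congr_fderiv ?_
  ext w
  simp only [ContinuousLinearMap.comp_apply, fderivInnerCLM_apply, ContinuousLinearMap.prod_apply,
    ContinuousLinearMap.id_apply, add_apply, innerSL_apply_apply]
  rw [real_inner_comm x, add_comm]

omit [FiniteDimensional ℝ E] in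
/-- Derivative of `Q = ‖V‖² + 2P`: `DQ(x) w = 2⟪V x, DV(x) w⟫ + 2 DP(x) w`. [folklore] -/
theorem hasFDerivAt_bernoulliFn (hV : DifferentiableAt ℝ V x) (hP : DifferentiableAt ℝ P x) :
    HasFDerivAt (fun y => ‖V y‖ ^ 2 + 2 * P y)
      (2 • (innerSL ℝ (V x)).comp (fderiv ℝ V x) + (2 : ℝ) • fderiv ℝ P x) x :=
  hV.hasFDerivAt.norm_sq.add (hP.hasFDerivAt.const_mul 2)

omit [FiniteDimensional ℝ E] in
/-- Derivative of `B = ‖x‖² Q` (product rule). [folklore] -/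
theorem hasFDerivAt_sphBernoulli (hV : DifferentiableAt ℝ V x) (hP : DifferentiableAt ℝ P x) :
    HasFDerivAt (fun y => ‖y‖ ^ 2 * (‖V y‖ ^ 2 + 2 * P y))
      (‖x‖ ^ 2 • (2 • (innerSL ℝ (V x)).comp (fderiv ℝ V x) + (2 : ℝ) • fderiv ℝ P x)
        + (‖V x‖ ^ 2 + 2 * P x) • (2 • innerSL ℝ x)) x :=
  ((hasStrictFDerivAt_norm_sq x).hasFDerivAt).mul (hasFDerivAt_bernoulliFn hV hP)

omit [FiniteDimensional ℝ E] in
/-- Derivative of `F/‖x‖²` off the origin (product and chain rules). [folklore] -/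
theorem hasFDerivAt_radialCoeff (hV : DifferentiableAt ℝ V x) (hx : x ≠ 0) :
    HasFDerivAt (fun y => ⟪V y, y⟫ * (‖y‖ ^ 2)⁻¹)
      (⟪V x, x⟫ • ((-((‖x‖ ^ 2) ^ 2)⁻¹) • (2 • innerSL ℝ x))
        + (‖x‖ ^ 2)⁻¹ • (innerSL ℝ (V x) + (innerSL ℝ x).comp (fderiv ℝ V x))) x := by
  have hn : HasFDerivAt (fun y : E => (‖y‖ ^ 2)⁻¹) ((-((‖x‖ ^ 2) ^ 2)⁻¹) • (2 • innerSL ℝ x)) x :=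
    (hasDerivAt_inv (by positivity)).comp_hasFDerivAt x (hasStrictFDerivAt_norm_sq x).hasFDerivAt
  exact (hasFDerivAt_normalPart hV).mul hn

omit [FiniteDimensional ℝ E] in
/-- Derivative of `T = V - (F/‖x‖²) x` off the origin. [folklore] -/
theorem hasFDerivAt_tangentialPart (hV : DifferentiableAt ℝ V x) (hx : x ≠ 0) :
    HasFDerivAt (fun y => V y - (⟪V y, y⟫ * (‖y‖ ^ 2)⁻¹) • y)
      (fderiv ℝ V x - ((⟪V x, x⟫ * (‖x‖ ^ 2)⁻¹) • ContinuousLinearMap.id ℝ E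
        + (fderiv ℝ (fun y => ⟪V y, y⟫ * (‖y‖ ^ 2)⁻¹) x).smulRight x)) x :=
  hV.hasFDerivAt.sub
    ((hasFDerivAt_radialCoeff hV hx).differentiableAt.hasFDerivAt.smul (hasFDerivAt_id x))

omit [FiniteDimensional ℝ E] in
/-- `∑ᵢ ⟪bᵢ, ℓ(bᵢ) v⟫ = ℓ v` for an orthonormal basis `b` (the trace of the rank-one map
`w ↦ ℓ(w) v`). [folklore] -/
theorem sum_inner_smul_eq_apply {ι : Type*} [Fintype ι] (b : OrthonormalBasis ι ℝ E)
    (ℓ : E →L[ℝ] ℝ) (v : E) : ∑ i, ⟪b i, ℓ (b i) • v⟫ = ℓ v := by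
  simp_rw [inner_smul_right]
  conv_rhs => rw [← b.sum_repr' v, map_sum]
  simp_rw [map_smul, smul_eq_mul, mul_comm]

/-- `⟪∇f(x), w⟫ = Df(x) w` (Riesz representation of the gradient). [folklore] -/
theorem inner_gradient_left (f : E → ℝ) (x w : E) : ⟪gradient f x, w⟫ = fderiv ℝ f x w := by
  rw [gradient, InnerProductSpace.toDual_symm_apply]

/-! #### The reduced system at `α = 1` in bulk form -/

section AlphaOne

variable (h : IsHomogeneousSteadyEuler 1 V P)
include h

/-- The momentum equation in inner-product form: `⟪DV(x) V(x), w⟫ = -DP(x) w` off the origin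
(Shvydkoy (1)). [folklore] -/
theorem inner_convect_eq (hx : x ≠ 0) (w : E) :
    ⟪fderiv ℝ V x (V x), w⟫ = -fderiv ℝ P x w := by
  have hm := h.momentum hx
  rw [convect_apply, add_eq_zero_iff_eq_neg] at hm
  rw [hm, inner_neg_left, inner_gradient_left]

/-- Euler's relation at `α = 1`: `DV(x) x = -V(x)`. [folklore] -/
theorem fderiv_velocity_self (hx : x ≠ 0) : fderiv ℝ V x x = -V x := by
  rw [h.fderiv_velocity_apply_self hx, neg_one_smul]

/-- Euler's relation at `α = 1`: `DP(x) x = -2 P(x)`. [folklore] -/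
theorem fderiv_pressure_self (hx : x ≠ 0) : fderiv ℝ P x x = -2 * P x := by
  rw [h.fderiv_pressure_apply_self hx]; ring

/-- `V·∇F = Q` (Shvydkoy's `v∇f = H` at `α = 1`, bulk form).
[cite: Shvydkoy2018, proof of Prop. 2.1] -/
theorem fderiv_normalPart_velocity (hx : x ≠ 0) :
    fderiv ℝ (fun y => ⟪V y, y⟫) x (V x) = ‖V x‖ ^ 2 + 2 * P x := by
  rw [(hasFDerivAt_normalPart (h.differentiableAt_velocity hx)).fderiv]
  simp only [add_apply, innerSL_apply_apply, ContinuousLinearMap.comp_apply,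
    real_inner_self_eq_norm_sq]
  rw [real_inner_comm, inner_convect_eq h hx, fderiv_pressure_self h hx]
  ring

/-- `x·∇F = 0` (`F` is `0`-homogeneous). [folklore] -/
theorem fderiv_normalPart_self (hx : x ≠ 0) : fderiv ℝ (fun y => ⟪V y, y⟫) x x = 0 := by
  rw [(hasFDerivAt_normalPart (h.differentiableAt_velocity hx)).fderiv]
  simp only [add_apply, innerSL_apply_apply, ContinuousLinearMap.comp_apply]
  rw [fderiv_velocity_self h hx, inner_neg_right, real_inner_comm]
  ring

/-- `V·∇Q = 0` (the Bernoulli function is transported: Shvydkoy's `v∇H = 2αfH` in bulk form).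
[cite: Shvydkoy2018, §2, transport equation for H] -/
theorem fderiv_bernoulliFn_velocity (hx : x ≠ 0) :
    fderiv ℝ (fun y => ‖V y‖ ^ 2 + 2 * P y) x (V x) = 0 := by
  rw [(hasFDerivAt_bernoulliFn (h.differentiableAt_velocity hx)
    (h.differentiableAt_pressure hx)).fderiv]
  simp only [add_apply, smul_apply, ContinuousLinearMap.comp_apply,
    innerSL_apply_apply, nsmul_eq_mul, smul_eq_mul]
  rw [real_inner_comm, inner_convect_eq h hx]
  ring

/-- `x·∇Q = -2Q` (`Q` is homogeneous of degree `-2`). [folklore] -/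
theorem fderiv_bernoulliFn_self (hx : x ≠ 0) :
    fderiv ℝ (fun y => ‖V y‖ ^ 2 + 2 * P y) x x = -2 * (‖V x‖ ^ 2 + 2 * P x) := by
  rw [(hasFDerivAt_bernoulliFn (h.differentiableAt_velocity hx)
    (h.differentiableAt_pressure hx)).fderiv]
  simp only [add_apply, smul_apply, ContinuousLinearMap.comp_apply,
    innerSL_apply_apply, nsmul_eq_mul, smul_eq_mul]
  rw [fderiv_velocity_self h hx, fderiv_pressure_self h hx, inner_neg_right,
    real_inner_self_eq_norm_sq]
  ring

/-- `V·∇B = 2 F Q` (Shvydkoy's `v∇H = 2fH` at `α = 1`, bulk form).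
[cite: Shvydkoy2018, proof of Prop. 2.1] -/
theorem fderiv_sphBernoulli_velocity (hx : x ≠ 0) :
    fderiv ℝ (fun y => ‖y‖ ^ 2 * (‖V y‖ ^ 2 + 2 * P y)) x (V x) =
      2 * ⟪V x, x⟫ * (‖V x‖ ^ 2 + 2 * P x) := by
  rw [(hasFDerivAt_sphBernoulli (h.differentiableAt_velocity hx)
    (h.differentiableAt_pressure hx)).fderiv]
  have hQ := fderiv_bernoulliFn_velocity h hx
  rw [(hasFDerivAt_bernoulliFn (h.differentiableAt_velocity hx)
    (h.differentiableAt_pressure hx)).fderiv] at hQ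
  simp only [add_apply, smul_apply, smul_eq_mul, innerSL_apply_apply] at hQ ⊢
  rw [hQ, real_inner_comm]
  ring

/-- `x·∇B = 0` (`B` is `0`-homogeneous). [folklore] -/
theorem fderiv_sphBernoulli_self (hx : x ≠ 0) :
    fderiv ℝ (fun y => ‖y‖ ^ 2 * (‖V y‖ ^ 2 + 2 * P y)) x x = 0 := by
  rw [(hasFDerivAt_sphBernoulli (h.differentiableAt_velocity hx)
    (h.differentiableAt_pressure hx)).fderiv]
  have hQ := fderiv_bernoulliFn_self h hx
  rw [(hasFDerivAt_bernoulliFn (h.differentiableAt_velocity hx)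
    (h.differentiableAt_pressure hx)).fderiv] at hQ
  simp only [add_apply, smul_apply, smul_eq_mul, innerSL_apply_apply] at hQ ⊢
  rw [hQ, real_inner_self_eq_norm_sq]
  ring

/-- `x·∇(F/‖x‖²) = -2 F/‖x‖²` (degree `-2` homogeneity). [folklore] -/
theorem fderiv_radialCoeff_self (hx : x ≠ 0) :
    fderiv ℝ (fun y => ⟪V y, y⟫ * (‖y‖ ^ 2)⁻¹) x x = -2 * (⟪V x, x⟫ * (‖x‖ ^ 2)⁻¹) := by
  rw [(hasFDerivAt_radialCoeff (h.differentiableAt_velocity hx) hx).fderiv]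
  have hF := fderiv_normalPart_self h hx
  rw [(hasFDerivAt_normalPart (h.differentiableAt_velocity hx)).fderiv] at hF
  simp only [add_apply, smul_apply, smul_eq_mul, innerSL_apply_apply] at hF ⊢
  rw [hF, real_inner_self_eq_norm_sq]
  have hx2 : ‖x‖ ^ 2 ≠ 0 := by positivity
  field_simp
  ring

/-- `div T = -(n - 2) F/‖x‖²` (in `ℝ³`: `div T = -F/‖x‖²`, i.e. Shvydkoy's `f + div v = 0`).
[cite: Shvydkoy2018, proof of Prop. 2.1 and Appendix] -/
theorem divergence_tangentialPart (hx : x ≠ 0) :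
    VectorCalculus.divergence (fun y => V y - (⟪V y, y⟫ * (‖y‖ ^ 2)⁻¹) • y) x =
      -((finrank ℝ E : ℝ) - 2) * (⟪V x, x⟫ * (‖x‖ ^ 2)⁻¹) := by
  set b := stdOrthonormalBasis ℝ E
  rw [divergence_eq_sum_inner_fderiv b,
    (hasFDerivAt_tangentialPart (h.differentiableAt_velocity hx) hx).fderiv]
  simp only [sub_apply, add_apply, smul_apply,
    ContinuousLinearMap.smulRight_apply, ContinuousLinearMap.id_apply, inner_sub_right,
    inner_add_right, Finset.sum_sub_distrib, Finset.sum_add_distrib]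
  rw [← divergence_eq_sum_inner_fderiv b, h.divergence_eq_zero hx, sum_inner_smul_eq_apply,
    fderiv_radialCoeff_self h hx]
  have hb : ∀ i, ⟪b i, (⟪V x, x⟫ * (‖x‖ ^ 2)⁻¹) • b i⟫ = ⟪V x, x⟫ * (‖x‖ ^ 2)⁻¹ :=
      fun i => by
    rw [inner_smul_right, real_inner_self_eq_norm_sq, b.orthonormal.1 i]; ring
  simp only [hb, Finset.sum_const, Finset.card_univ, Fintype.card_fin, nsmul_eq_mul]
  ring

end AlphaOne


/-! #### A radial cutoff and globalisation off the origin -/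

/-- **A radial cutoff.** There is a `C¹` function `ψ ≥ 0` on `E` with compact support, vanishing
near the origin, equal to `1` on the sphere `‖x‖² = 4`, and with radial gradient (`Dψ(x) w = 0`
for `w ⊥ x`): `ψ(x) = χ(‖x‖²)` for a smooth bump `χ` on `ℝ` centred at `4`, equal to `1` on
`[3, 5]` and supported in `(2, 6)`. [folklore] -/
theorem exists_radial_cutoff : ∃ ψ : E → ℝ, ContDiff ℝ 1 ψ ∧ (∀ x, 0 ≤ ψ x) ∧
    HasCompactSupport ψ ∧ ψ =ᶠ[𝓝 0] 0 ∧ (∀ x, ‖x‖ ^ 2 = 4 → ψ x = 1) ∧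
    ∀ x w, ⟪x, w⟫ = 0 → fderiv ℝ ψ x w = 0 := by
  let χ : ContDiffBump (4 : ℝ) := ⟨1, 2, one_pos, one_lt_two⟩
  have hzero : ∀ x : E, ‖x‖ ^ 2 ≤ 2 ∨ 6 ≤ ‖x‖ ^ 2 → χ (‖x‖ ^ 2) = 0 := by
    intro x hx
    apply χ.zero_of_le_dist
    show (2 : ℝ) ≤ dist (‖x‖ ^ 2) 4
    rw [Real.dist_eq]
    rcases hx with hx | hx
    · rw [abs_sub_comm, abs_of_nonneg (by linarith)]
      linarith
    · rw [abs_of_nonneg (by linarith)]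
      linarith
  refine ⟨fun x => χ (‖x‖ ^ 2), χ.contDiff.comp (contDiff_norm_sq ℝ), fun x => χ.nonneg, ?_, ?_,
    ?_, ?_⟩
  · refine HasCompactSupport.intro (isCompact_closedBall (0 : E) 3) fun x hx => ?_
    rw [Metric.mem_closedBall, dist_zero_right, not_le] at hx
    exact hzero x (Or.inr (by nlinarith [norm_nonneg x]))
  · filter_upwards [Metric.ball_mem_nhds (0 : E) one_pos] with x hx
    rw [mem_ball_zero_iff] at hx
    exact hzero x (Or.inl (by nlinarith [norm_nonneg x]))
  · intro x hx
    apply χ.one_of_mem_closedBall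
    show ‖x‖ ^ 2 ∈ Metric.closedBall (4 : ℝ) 1
    rw [hx, Metric.mem_closedBall, dist_self]
    norm_num
  · intro x w hw
    have h := ((χ.contDiff (n := 1)).differentiable one_ne_zero
      (‖x‖ ^ 2)).hasDerivAt.comp_hasFDerivAt x (hasStrictFDerivAt_norm_sq x).hasFDerivAt
    rw [show (fun x : E => χ (‖x‖ ^ 2)) = (χ : ℝ → ℝ) ∘ fun x => ‖x‖ ^ 2 from rfl, h.fderiv]
    simp [hw]

omit [InnerProductSpace ℝ E] [FiniteDimensional ℝ E] in
/-- A function continuous off the origin and vanishing near the origin is continuous. [folklore] -/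
theorem continuous_of_off_origin [NormedSpace ℝ E] {β : Type*} [TopologicalSpace β] [Zero β]
    {k : E → β} (hk : ContinuousOn k {x | x ≠ 0}) (h0 : k =ᶠ[𝓝 0] 0) : Continuous k := by
  rw [continuous_iff_continuousAt]
  intro x
  rcases eq_or_ne x 0 with rfl | hx
  · exact (continuousAt_congr h0).mpr continuousAt_const
  · exact hk.continuousAt (isOpen_ne.mem_nhds hx)

omit [InnerProductSpace ℝ E] [FiniteDimensional ℝ E] in
/-- A function `C^n` off the origin and vanishing near the origin is `C^n`. [folklore] -/
theorem contDiff_of_off_origin [NormedSpace ℝ E] {F' : Type*} [NormedAddCommGroup F']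
    [NormedSpace ℝ F'] {k : E → F'} {n : ℕ∞} (hk : ContDiffOn ℝ n k {x | x ≠ 0})
    (h0 : k =ᶠ[𝓝 0] 0) : ContDiff ℝ n k := by
  rw [contDiff_iff_contDiffAt]
  intro x
  rcases eq_or_ne x 0 with rfl | hx
  · exact (contDiffAt_const (c := (0 : F'))).congr_of_eventuallyEq h0
  · exact hk.contDiffAt (isOpen_ne.mem_nhds hx)

/-! #### Integration by parts against a field supported off the origin -/

section IBP

variable [MeasurableSpace E] [BorelSpace E]

/-- **Integration by parts off the origin**: for a `C¹` vector field `W` compactly supported in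
`E ∖ {0}` and a function `G` that is `C¹` on `E ∖ {0}`, `∫ (DG·W + G div W) = 0` (the integral
of `div (G W)`; Evans, *PDE*, App. C.2, via Mathlib's coordinatewise integration by parts
`integral_bilinear_hasFDerivAt_right_eq_neg_left_of_integrable`). [folklore] -/
theorem integral_fderiv_apply_add_mul_divergence_eq_zero (μ : Measure E) [μ.IsAddHaarMeasure]
    {W : E → E} {G : E → ℝ} (hW : ContDiffOn ℝ 1 W {x | x ≠ 0}) (hW0 : W =ᶠ[𝓝 0] 0)
    (hWc : HasCompactSupport W) (hG : ContDiffOn ℝ 1 G {x | x ≠ 0}) :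
    ∫ x, (fderiv ℝ G x (W x) + G x * VectorCalculus.divergence W x) ∂μ = 0 := by
  set b := stdOrthonormalBasis ℝ E
  have hWd : ContDiff ℝ 1 W := contDiff_of_off_origin hW hW0
  have hWcont : Continuous W := hWd.continuous
  have hDW : Continuous (fderiv ℝ W) := hWd.continuous_fderiv one_ne_zero
  have hDW0 : (fderiv ℝ W) =ᶠ[𝓝 0] 0 := by
    filter_upwards [eventually_eventually_nhds.mpr hW0] with y hy
    rw [Filter.EventuallyEq.fderiv_eq (hy : W =ᶠ[𝓝 y] 0)]
    simp
  have hsuppW : tsupport W ⊆ {x | x ≠ 0} := by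
    intro x hx h0
    rw [(h0 : x = 0)] at hx
    exact (notMem_tsupport_iff_eventuallyEq.mpr hW0) hx
  have hGc : ContinuousOn G {x | x ≠ 0} := hG.continuousOn
  have hDGc : ContinuousOn (fderiv ℝ G) {x | x ≠ 0} :=
    hG.continuousOn_fderiv_of_isOpen isOpen_ne le_rfl
  -- the three families of products are continuous with compact support, hence integrable
  have hI1 : ∀ i, Integrable (fun x => fderiv ℝ G x (b i) * ⟪b i, W x⟫) μ := by
    intro i
    refine Continuous.integrable_of_hasCompactSupport ?_ ?_
    · refine continuous_of_off_origin ((hDGc.clm_apply continuousOn_const).mul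
        (continuousOn_const.inner hWcont.continuousOn)) ?_
      filter_upwards [hW0] with x hx
      simp [hx]
    · exact hWc.mono (Function.support_subset_iff'.mpr fun x hx => by
        simp [Function.notMem_support.mp hx])
  have hI2 : ∀ i, Integrable (fun x => G x * ⟪b i, fderiv ℝ W x (b i)⟫) μ := by
    intro i
    refine Continuous.integrable_of_hasCompactSupport ?_ ?_
    · refine continuous_of_off_origin (hGc.mul (continuousOn_const.inner
        ((hDW.clm_apply continuous_const).continuousOn))) ?_
      filter_upwards [hDW0] with x hx
      simp [hx]
    · exact (hWc.fderiv_apply (𝕜 := ℝ) (b i)).mono (Function.support_subset_iff'.mpr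
        fun x hx => by simp [Function.notMem_support.mp hx])
  have hI3 : ∀ i, Integrable (fun x => G x * ⟪b i, W x⟫) μ := by
    intro i
    refine Continuous.integrable_of_hasCompactSupport ?_ ?_
    · refine continuous_of_off_origin (hGc.mul (continuousOn_const.inner hWcont.continuousOn)) ?_
      filter_upwards [hW0] with x hx
      simp [hx]
    · exact hWc.mono (Function.support_subset_iff'.mpr fun x hx => by
        simp [Function.notMem_support.mp hx])
  -- integration by parts, one coordinate at a time
  have hibp : ∀ i, ∫ x, G x * ⟪b i, fderiv ℝ W x (b i)⟫ ∂μ =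
      -∫ x, fderiv ℝ G x (b i) * ⟪b i, W x⟫ ∂μ := by
    intro i
    have hsupp_g : tsupport (fun x => ⟪b i, W x⟫) ⊆ tsupport W :=
      closure_mono (Function.support_subset_iff'.mpr fun x hx => by
        simp [Function.notMem_support.mp hx])
    have h := integral_bilinear_hasFDerivAt_right_eq_neg_left_of_integrable (μ := μ)
      (f := G) (f' := fderiv ℝ G) (g := fun x => ⟪b i, W x⟫)
      (g' := fun x => (innerSL ℝ (b i)).comp (fderiv ℝ W x)) (v := b i)
      (B := ContinuousLinearMap.mul ℝ ℝ)
      (by simpa using hI1 i) (by simpa using hI2 i) (by simpa using hI3 i)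
      (fun x hx => ((hG.differentiableOn one_ne_zero).differentiableAt
        (isOpen_ne.mem_nhds (hsuppW (hsupp_g hx)))).hasFDerivAt)
      (fun x _ => (innerSL ℝ (b i)).hasFDerivAt.comp x
        (hWd.differentiable one_ne_zero x).hasFDerivAt)
    simpa using h
  -- expand `DG·W + G div W` in the orthonormal frame `b`
  have hexp : ∀ x, fderiv ℝ G x (W x) + G x * VectorCalculus.divergence W x =
      ∑ i, (fderiv ℝ G x (b i) * ⟪b i, W x⟫ + G x * ⟪b i, fderiv ℝ W x (b i)⟫) := by
    intro x
    rw [Finset.sum_add_distrib, ← Finset.mul_sum, ← divergence_eq_sum_inner_fderiv b W x]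
    congr 1
    conv_lhs => rw [← b.sum_repr' (W x)]
    rw [map_sum]
    refine Finset.sum_congr rfl fun i _ => ?_
    rw [map_smul, smul_eq_mul, mul_comm]
  simp_rw [hexp]
  set Φ : Fin (finrank ℝ E) → E → ℝ := fun i x =>
    fderiv ℝ G x (b i) * ⟪b i, W x⟫ + G x * ⟪b i, fderiv ℝ W x (b i)⟫
  have hΦ : ∀ i, Integrable (Φ i) μ := fun i => (hI1 i).add (hI2 i)
  show ∫ x, ∑ i, Φ i x ∂μ = 0
  rw [integral_finsetSum _ fun i _ => hΦ i]
  refine Finset.sum_eq_zero fun i _ => ?_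
  show ∫ x, (fderiv ℝ G x (b i) * ⟪b i, W x⟫ + G x * ⟪b i, fderiv ℝ W x (b i)⟫) ∂μ = 0
  rw [integral_add (hI1 i) (hI2 i), hibp i]
  ring

end IBP

/-! #### Step 1 of the printed proof: `H = f = 0` -/

omit [FiniteDimensional ℝ E] in
/-- `div (c T) = c div T + Dc(T)`. [folklore] -/
theorem divergence_smul_apply {ι : Type*} [Fintype ι] (b : OrthonormalBasis ι ℝ E)
    {c : E → ℝ} {T : E → E} {x : E}
    (hc : DifferentiableAt ℝ c x) (hT : DifferentiableAt ℝ T x) :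
    VectorCalculus.divergence (fun y => c y • T y) x =
      c x * VectorCalculus.divergence T x + fderiv ℝ c x (T x) := by
  have hd : HasFDerivAt (fun y => c y • T y)
      (c x • fderiv ℝ T x + (fderiv ℝ c x).smulRight (T x)) x :=
    hc.hasFDerivAt.smul hT.hasFDerivAt
  rw [divergence_eq_sum_inner_fderiv b, divergence_eq_sum_inner_fderiv b, hd.fderiv]
  simp only [add_apply, smul_apply, ContinuousLinearMap.smulRight_apply, inner_add_right,
    Finset.sum_add_distrib, sum_inner_smul_eq_apply]
  simp only [inner_smul_right, Finset.mul_sum]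

omit [FiniteDimensional ℝ E] in
/-- The tangential part is tangential: `⟪x, T x⟫ = 0` for `x ≠ 0`. [folklore] -/
theorem inner_self_tangentialPart (V : E → E) {x : E} (hx : x ≠ 0) :
    ⟪x, V x - (⟪V x, x⟫ * (‖x‖ ^ 2)⁻¹) • x⟫ = 0 := by
  have hx2 : ‖x‖ ^ 2 ≠ 0 := pow_ne_zero 2 (norm_ne_zero_iff.mpr hx)
  rw [inner_sub_right, inner_smul_right, real_inner_self_eq_norm_sq, real_inner_comm]
  field_simp
  ring

section AlphaOneIntegral

variable (h : IsHomogeneousSteadyEuler 1 V P)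
include h

/-- `F` is homogeneous of degree `0` at `α = 1`: `F(c x) = F(x)`, `c > 0`. [folklore] -/
theorem normalPart_smul ⦃c : ℝ⦄ (hc : 0 < c) (hx : x ≠ 0) :
    ⟪V (c • x), c • x⟫ = ⟪V x, x⟫ := by
  rw [h.velocity_smul_of_alpha_one hc hx, inner_smul_left, inner_smul_right]
  simp only [conj_trivial]
  field_simp

/-- `B` is homogeneous of degree `0` at `α = 1`: `B(c x) = B(x)`, `c > 0`. [folklore] -/
theorem sphBernoulli_smul ⦃c : ℝ⦄ (hc : 0 < c) (hx : x ≠ 0) :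
    ‖c • x‖ ^ 2 * (‖V (c • x)‖ ^ 2 + 2 * P (c • x)) = ‖x‖ ^ 2 * (‖V x‖ ^ 2 + 2 * P x) := by
  rw [h.velocity_smul_of_alpha_one hc hx, h.pressure_smul_of_alpha_one hc hx, norm_smul,
    norm_smul, Real.norm_eq_abs, Real.norm_eq_abs, abs_of_pos hc, abs_of_pos (inv_pos.mpr hc)]
  field_simp

/-- `F` is `C¹` off the origin. [folklore] -/
theorem contDiffOn_normalPart : ContDiffOn ℝ 1 (fun y => ⟪V y, y⟫) {x | x ≠ 0} :=
  h.contDiffOn_velocity.inner ℝ contDiffOn_id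

/-- `Q` is `C¹` off the origin. [folklore] -/
theorem contDiffOn_bernoulliFn : ContDiffOn ℝ 1 (fun y => ‖V y‖ ^ 2 + 2 * P y) {x | x ≠ 0} :=
  (h.contDiffOn_velocity.norm_sq ℝ).add (contDiffOn_const.mul h.contDiffOn_pressure)

/-- `B` is `C¹` off the origin. [folklore] -/
theorem contDiffOn_sphBernoulli :
    ContDiffOn ℝ 1 (fun y => ‖y‖ ^ 2 * (‖V y‖ ^ 2 + 2 * P y)) {x | x ≠ 0} :=
  (contDiffOn_id.norm_sq ℝ).mul (contDiffOn_bernoulliFn h)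

/-- `F/‖x‖²` is `C¹` off the origin. [folklore] -/
theorem contDiffOn_radialCoeff : ContDiffOn ℝ 1 (fun y => ⟪V y, y⟫ * (‖y‖ ^ 2)⁻¹) {x | x ≠ 0} :=
  (contDiffOn_normalPart h).mul ((contDiffOn_id.norm_sq ℝ).inv
    fun _ hx => pow_ne_zero 2 (norm_ne_zero_iff.mpr hx))

/-- `T` is `C¹` off the origin. [folklore] -/
theorem contDiffOn_tangentialPart :
    ContDiffOn ℝ 1 (fun y => V y - (⟪V y, y⟫ * (‖y‖ ^ 2)⁻¹) • y) {x | x ≠ 0} :=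
  h.contDiffOn_velocity.sub ((contDiffOn_radialCoeff h).smul contDiffOn_id)

/-- **Shvydkoy's integral identity** `-∫ H² dσ = ⅓ ∫ f⁴ dσ` in bulk form: for a radial
cutoff `ψ` (compactly supported off the origin, `Dψ(x) ⊥ x^⊥`),
`∫ ψ (B² + F⁴/3)/‖x‖² dx = 0`. It is `∫ div (G ψ T) = 0` for `G = F B - F³/3`, expanded with
`T·∇F = Q`, `T·∇B = 2FQ`, `div T = -F/‖x‖²`, `T·∇ψ = 0` — the two integrations by parts of the
printed proof rolled into one. [cite: Shvydkoy2018, Prop. 2.1] -/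
theorem integral_identity [MeasurableSpace E] [BorelSpace E] (μ : Measure E) [μ.IsAddHaarMeasure]
    (h3 : finrank ℝ E = 3) {ψ : E → ℝ} (hψ : ContDiff ℝ 1 ψ) (hψc : HasCompactSupport ψ)
    (hψ0 : ψ =ᶠ[𝓝 0] 0) (hψr : ∀ x w, ⟪x, w⟫ = 0 → fderiv ℝ ψ x w = 0) :
    ∫ x, ψ x * ((‖x‖ ^ 2 * (‖V x‖ ^ 2 + 2 * P x)) ^ 2 + ⟪V x, x⟫ ^ 4 * 3⁻¹) * (‖x‖ ^ 2)⁻¹ ∂μ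
      = 0 := by
  set W : E → E := fun x => ψ x • (V x - (⟪V x, x⟫ * (‖x‖ ^ 2)⁻¹) • x) with hW
  set G : E → ℝ := fun x =>
    ⟪V x, x⟫ * (‖x‖ ^ 2 * (‖V x‖ ^ 2 + 2 * P x)) - ⟪V x, x⟫ ^ 3 * 3⁻¹ with hG
  have hWreg : ContDiffOn ℝ 1 W {x | x ≠ 0} := hψ.contDiffOn.smul (contDiffOn_tangentialPart h)
  have hW0 : W =ᶠ[𝓝 0] 0 := hψ0.mono fun x hx => by
    simp only [hW, Pi.zero_apply] at hx ⊢
    simp [hx]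
  have hWc : HasCompactSupport W := hψc.smul_right
  have hGreg : ContDiffOn ℝ 1 G {x | x ≠ 0} :=
    ((contDiffOn_normalPart h).mul (contDiffOn_sphBernoulli h)).sub
      (((contDiffOn_normalPart h).pow 3).mul contDiffOn_const)
  have key := integral_fderiv_apply_add_mul_divergence_eq_zero μ hWreg hW0 hWc hGreg
  -- the pointwise identity `DG·W + G div W = ψ (B² + F⁴/3)/‖x‖²`
  have hpt : ∀ x, fderiv ℝ G x (W x) + G x * VectorCalculus.divergence W x =
      ψ x * ((‖x‖ ^ 2 * (‖V x‖ ^ 2 + 2 * P x)) ^ 2 + ⟪V x, x⟫ ^ 4 * 3⁻¹) * (‖x‖ ^ 2)⁻¹ := by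
    intro x
    rcases eq_or_ne x 0 with rfl | hx
    · have hc0 : ψ (0 : E) = 0 := hψ0.eq_of_nhds
      have hDW0 : fderiv ℝ W 0 = 0 := by
        rw [hW0.fderiv_eq]; simp
      have hW00 : W 0 = 0 := by simp [hW, hc0]
      simp [hW00, hc0, VectorCalculus.divergence, hDW0]
    have hVd := h.differentiableAt_velocity hx
    have hPd := h.differentiableAt_pressure hx
    have hFd : HasFDerivAt (fun y => ⟪V y, y⟫) (fderiv ℝ (fun y => ⟪V y, y⟫) x) x :=
      (hasFDerivAt_normalPart hVd).differentiableAt.hasFDerivAt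
    have hBd : HasFDerivAt (fun y => ‖y‖ ^ 2 * (‖V y‖ ^ 2 + 2 * P y))
        (fderiv ℝ (fun y => ‖y‖ ^ 2 * (‖V y‖ ^ 2 + 2 * P y)) x) x :=
      (hasFDerivAt_sphBernoulli hVd hPd).differentiableAt.hasFDerivAt
    have hGd : HasFDerivAt G (⟪V x, x⟫ • fderiv ℝ (fun y => ‖y‖ ^ 2 * (‖V y‖ ^ 2 + 2 * P y)) x
        + (‖x‖ ^ 2 * (‖V x‖ ^ 2 + 2 * P x)) • fderiv ℝ (fun y => ⟪V y, y⟫) x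
        - (3 : ℝ)⁻¹ • ((3 • ⟪V x, x⟫ ^ (3 - 1)) • fderiv ℝ (fun y => ⟪V y, y⟫) x)) x :=
      (hFd.mul hBd).sub ((hFd.pow 3).mul_const _)
    have hTd : DifferentiableAt ℝ (fun y => V y - (⟪V y, y⟫ * (‖y‖ ^ 2)⁻¹) • y) x :=
      (hasFDerivAt_tangentialPart hVd hx).differentiableAt
    have hcd : DifferentiableAt ℝ ψ x := hψ.differentiable one_ne_zero x
    -- divergence of `W = ψ T`
    have hdivW : VectorCalculus.divergence W x = -(ψ x * (⟪V x, x⟫ * (‖x‖ ^ 2)⁻¹)) := by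
      rw [hW, divergence_smul_apply (stdOrthonormalBasis ℝ E) hcd hTd,
        divergence_tangentialPart h hx, h3, hψr x _ (inner_self_tangentialPart V hx)]
      norm_num
    -- the derivative of `G` along `T`
    have hFT : fderiv ℝ (fun y => ⟪V y, y⟫) x (V x - (⟪V x, x⟫ * (‖x‖ ^ 2)⁻¹) • x) =
        ‖V x‖ ^ 2 + 2 * P x := by
      rw [map_sub, map_smul, fderiv_normalPart_velocity h hx, fderiv_normalPart_self h hx,
        smul_zero, sub_zero]
    have hBT : fderiv ℝ (fun y => ‖y‖ ^ 2 * (‖V y‖ ^ 2 + 2 * P y)) x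
        (V x - (⟪V x, x⟫ * (‖x‖ ^ 2)⁻¹) • x) = 2 * ⟪V x, x⟫ * (‖V x‖ ^ 2 + 2 * P x) := by
      rw [map_sub, map_smul, fderiv_sphBernoulli_velocity h hx, fderiv_sphBernoulli_self h hx,
        smul_zero, sub_zero]
    have hx2 : ‖x‖ ^ 2 ≠ 0 := pow_ne_zero 2 (norm_ne_zero_iff.mpr hx)
    rw [hdivW, hW, map_smul, hGd.fderiv]
    simp only [sub_apply, add_apply, smul_apply, smul_eq_mul, hFT, hBT, nsmul_eq_mul]
    simp only [hG]
    field_simp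
    ring
  simp_rw [hpt] at key
  exact key

/-- **Step 1 of Shvydkoy's proof of Prop. 2.1** (`H = f = 0`): for a `C¹` homogeneous stationary
Euler pair at `α = 1` in dimension `3`, `F = ⟪V, x⟫ ≡ 0` (the flow is tangential) and
`B = ‖x‖² (‖V‖² + 2P) ≡ 0` (the Bernoulli function vanishes) off the origin.
[cite: Shvydkoy2018, Prop. 2.1] -/
theorem normalPart_eq_zero_and_sphBernoulli_eq_zero (h3 : finrank ℝ E = 3) ⦃x : E⦄ (hx : x ≠ 0) :
    ⟪V x, x⟫ = 0 ∧ ‖x‖ ^ 2 * (‖V x‖ ^ 2 + 2 * P x) = 0 := by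
  letI : MeasurableSpace E := borel E
  haveI : BorelSpace E := ⟨rfl⟩
  let μ : Measure E := (stdOrthonormalBasis ℝ E).toBasis.addHaar
  obtain ⟨ψ, hψ, hψnn, hψc, hψ0, hψ1, hψr⟩ := exists_radial_cutoff (E := E)
  set g : E → ℝ := fun x =>
    ψ x * ((‖x‖ ^ 2 * (‖V x‖ ^ 2 + 2 * P x)) ^ 2 + ⟪V x, x⟫ ^ 4 * 3⁻¹) * (‖x‖ ^ 2)⁻¹ with hg
  have hint : ∫ x, g x ∂μ = 0 := integral_identity h μ h3 hψ hψc hψ0 hψr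
  have hcont : Continuous g := by
    refine continuous_of_off_origin ?_ ?_
    · refine (hψ.continuous.continuousOn.mul
        (((contDiffOn_sphBernoulli h).continuousOn.pow 2).add
        (((contDiffOn_normalPart h).continuousOn.pow 4).mul continuousOn_const))).mul ?_
      exact ((continuousOn_id.norm).pow 2).inv₀ fun x hx => pow_ne_zero 2 (norm_ne_zero_iff.mpr hx)
    · filter_upwards [hψ0] with y hy
      simp [hg, hy]
  have hnn : 0 ≤ g := fun y => by
    simp only [hg, Pi.zero_apply]
    have := hψnn y
    positivity
  have hgc : HasCompactSupport g := (hψc.mul_right).mul_right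
  have hae : g =ᵐ[μ] 0 :=
    (integral_eq_zero_iff_of_nonneg hnn (hcont.integrable_of_hasCompactSupport hgc)).mp hint
  have hzero : g = 0 := (Continuous.ae_eq_iff_eq μ hcont continuous_const).mp hae
  -- evaluate on the sphere `‖y‖ = 2`, where `ψ = 1`
  set c : ℝ := 2 * ‖x‖⁻¹ with hc
  have hxn : 0 < ‖x‖ := norm_pos_iff.mpr hx
  have hcpos : 0 < c := by positivity
  have hy : ‖c • x‖ ^ 2 = 4 := by
    rw [norm_smul, Real.norm_eq_abs, abs_of_pos hcpos, hc]
    field_simp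
    norm_num
  have hgy := congr_fun hzero (c • x)
  simp only [hg, Pi.zero_apply, hψ1 _ hy, one_mul, normalPart_smul h hcpos hx,
    sphBernoulli_smul h hcpos hx] at hgy
  rw [hy] at hgy
  have hsum : (‖x‖ ^ 2 * (‖V x‖ ^ 2 + 2 * P x)) ^ 2 + ⟪V x, x⟫ ^ 4 * 3⁻¹ = 0 :=
    (mul_eq_zero.mp hgy).resolve_right (by norm_num)
  have hB2 : 0 ≤ (‖x‖ ^ 2 * (‖V x‖ ^ 2 + 2 * P x)) ^ 2 := sq_nonneg _
  have hF4 : 0 ≤ ⟪V x, x⟫ ^ 4 := by positivity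
  have h1 : (‖x‖ ^ 2 * (‖V x‖ ^ 2 + 2 * P x)) ^ 2 = 0 := by nlinarith
  have h2 : ⟪V x, x⟫ ^ 4 = 0 := by nlinarith
  exact ⟨pow_eq_zero_iff (n := 4) (by norm_num) |>.mp h2,
    pow_eq_zero_iff (n := 2) (by norm_num) |>.mp h1⟩

end AlphaOneIntegral


/-! #### Step 2 of the printed proof: `ω v^⊥ = 0`, hence `dv = 0` (symmetry of `DV`) -/

/-- **Linear algebra in dimension `3`**: if `w ↦ ⟪A u, w⟫ - ⟪A w, u⟫` vanishes for `u = a` and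
for `u = c`, where `a ⊥ c` are nonzero, then `A` is symmetric (a skew form on `ℝ³` vanishing on a
plane vanishes: its restriction to the orthogonal line is skew, hence zero). [folklore] -/
theorem inner_symm_of_pair (h3 : finrank ℝ E = 3) (A : E →L[ℝ] E) {a c : E} (ha : a ≠ 0)
    (hc : c ≠ 0) (hac : ⟪a, c⟫ = 0) (hAa : ∀ w, ⟪A a, w⟫ = ⟪A w, a⟫)
    (hAc : ∀ w, ⟪A c, w⟫ = ⟪A w, c⟫) (u w : E) : ⟪A u, w⟫ = ⟪A w, u⟫ := by
  -- the skew form `S u w = ⟪A u, w⟫ - ⟪A w, u⟫`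
  set S : E →ₗ[ℝ] E →ₗ[ℝ] ℝ :=
    (innerₗ E).comp A.toLinearMap - ((innerₗ E).comp A.toLinearMap).flip with hSdef
  have hS : ∀ u w, S u w = ⟪A u, w⟫ - ⟪A w, u⟫ := fun u w => rfl
  have hSskew : ∀ u w, S u w = -S w u := fun u w => by rw [hS, hS]; ring
  -- `a`, `c` and hence their span `L` lie in the kernel
  set L : Submodule ℝ E := Submodule.span ℝ (Set.range ![a, c]) with hLdef
  have hLker : L ≤ LinearMap.ker S := by
    rw [hLdef, Submodule.span_le]
    rintro _ ⟨i, rfl⟩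
    rw [SetLike.mem_coe, LinearMap.mem_ker]
    ext w
    fin_cases i
    · simp [hS, hAa]
    · simp [hS, hAc]
  have hLS : ∀ l ∈ L, ∀ w, S l w = 0 := fun l hl w => by
    have := hLker hl
    rw [LinearMap.mem_ker] at this
    rw [this, LinearMap.zero_apply]
  -- `L` has dimension `2`, so `Lᗮ` is a line
  have hli : LinearIndependent ℝ ![a, c] := by
    apply linearIndependent_of_ne_zero_of_inner_eq_zero
    · intro i
      fin_cases i <;> simpa
    · intro i j hij
      fin_cases i <;> fin_cases j <;> simp_all [real_inner_comm]
  have hLrank : finrank ℝ L = 2 := by simpa using finrank_span_eq_card hli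
  have hLperp : finrank ℝ Lᗮ = 1 :=
    Submodule.finrank_add_finrank_orthogonal' (by rw [hLrank, h3])
  obtain ⟨z, -, hz⟩ := finrank_eq_one_iff'.mp hLperp
  have hgen : ∀ m ∈ Lᗮ, ∃ r : ℝ, m = r • (z : E) := fun m hm => by
    obtain ⟨r, hr⟩ := hz ⟨m, hm⟩
    exact ⟨r, by simpa using (congrArg Subtype.val hr).symm⟩
  -- decompose along `L ⊕ Lᗮ`
  have key : S u w = 0 := by
    obtain ⟨l, hl, m, hm, rfl⟩ := Submodule.exists_add_mem_mem_orthogonal (K := L) u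
    obtain ⟨l', hl', m', hm', rfl⟩ := Submodule.exists_add_mem_mem_orthogonal (K := L) w
    obtain ⟨r, rfl⟩ := hgen m hm
    obtain ⟨r', rfl⟩ := hgen m' hm'
    have hzz : S z z = 0 := by linarith [hSskew z z]
    simp only [map_add, map_smul, LinearMap.add_apply, LinearMap.smul_apply, smul_eq_mul]
    rw [hLS l hl, hLS l hl, hSskew (z : E) l', hLS l' hl', hzz]
    ring
  rw [hS] at key
  linarith

section Curl

variable (h : IsHomogeneousSteadyEuler 1 V P) (h3 : finrank ℝ E = 3)
include h h3

/-- `H = 0` in bulk form: `Q = ‖V‖² + 2P ≡ 0` off the origin. [cite: Shvydkoy2018, Prop. 2.1] -/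
theorem bernoulliFn_eq_zero (hx : x ≠ 0) : ‖V x‖ ^ 2 + 2 * P x = 0 :=
  (mul_eq_zero.mp (normalPart_eq_zero_and_sphBernoulli_eq_zero h h3 hx).2).resolve_left
    (pow_ne_zero 2 (norm_ne_zero_iff.mpr hx))

/-- `F ≡ 0` on the open set `E ∖ {0}`, hence `DF = 0` there. [cite: Shvydkoy2018, Prop. 2.1] -/
theorem fderiv_normalPart_eq_zero (hx : x ≠ 0) : fderiv ℝ (fun y => ⟪V y, y⟫) x = 0 := by
  have h0 : (fun y => ⟪V y, y⟫) =ᶠ[𝓝 x] fun _ => 0 := by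
    filter_upwards [isOpen_ne.mem_nhds hx] with y hy
    exact (normalPart_eq_zero_and_sphBernoulli_eq_zero h h3 hy).1
  rw [h0.fderiv_eq]
  simp

/-- `Q ≡ 0` on the open set `E ∖ {0}`, hence `DQ = 0` there. [cite: Shvydkoy2018, Prop. 2.1] -/
theorem fderiv_bernoulliFn_eq_zero (hx : x ≠ 0) :
    fderiv ℝ (fun y => ‖V y‖ ^ 2 + 2 * P y) x = 0 := by
  have h0 : (fun y => ‖V y‖ ^ 2 + 2 * P y) =ᶠ[𝓝 x] fun _ => 0 := by
    filter_upwards [isOpen_ne.mem_nhds hx] with y hy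
    exact bernoulliFn_eq_zero h h3 hy
  rw [h0.fderiv_eq]
  simp

/-- `⟪DV w, x⟫ = -⟪V x, w⟫` off the origin (from `D F = 0`). [cite: Shvydkoy2018, Prop. 2.1] -/
theorem inner_fderiv_velocity_point (hx : x ≠ 0) (w : E) :
    ⟪fderiv ℝ V x w, x⟫ = -⟪V x, w⟫ := by
  have h0 := fderiv_normalPart_eq_zero h h3 hx
  rw [(hasFDerivAt_normalPart (h.differentiableAt_velocity hx)).fderiv] at h0
  have h1 := congrArg (fun L : E →L[ℝ] ℝ => L w) h0
  simp only [add_apply, innerSL_apply_apply, ContinuousLinearMap.comp_apply,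
    zero_apply] at h1
  rw [real_inner_comm]
  linarith

/-- `⟪DV w, V x⟫ = -DP w` off the origin (from `D Q = 0`). [cite: Shvydkoy2018, Prop. 2.1] -/
theorem inner_fderiv_velocity_velocity (hx : x ≠ 0) (w : E) :
    ⟪fderiv ℝ V x w, V x⟫ = -fderiv ℝ P x w := by
  have h0 := fderiv_bernoulliFn_eq_zero h h3 hx
  rw [(hasFDerivAt_bernoulliFn (h.differentiableAt_velocity hx)
    (h.differentiableAt_pressure hx)).fderiv] at h0
  have h1 := congrArg (fun L : E →L[ℝ] ℝ => L w) h0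
  simp only [add_apply, smul_apply, innerSL_apply_apply, ContinuousLinearMap.comp_apply,
    zero_apply, nsmul_eq_mul, smul_eq_mul, Nat.cast_ofNat] at h1
  rw [real_inner_comm]
  linarith

/-- At a point where `V ≠ 0`, `DV` is symmetric (`ω = 0` on `{v ≠ 0}`).
[cite: Shvydkoy2018, Prop. 2.1] -/
theorem fderiv_velocity_symmetric_of_ne (hx : x ≠ 0) (hVx : V x ≠ 0) (u w : E) :
    ⟪fderiv ℝ V x u, w⟫ = ⟪fderiv ℝ V x w, u⟫ := by
  refine inner_symm_of_pair h3 (fderiv ℝ V x) hVx hx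
    (normalPart_eq_zero_and_sphBernoulli_eq_zero h h3 hx).1 (fun w' => ?_) (fun w' => ?_) u w
  · rw [inner_convect_eq h hx, inner_fderiv_velocity_velocity h h3 hx]
  · rw [fderiv_velocity_self h hx, inner_neg_left, inner_fderiv_velocity_point h h3 hx]

/-- **Step 2 of Shvydkoy's proof of Prop. 2.1** (`dv = 0` throughout): `DV(x)` is symmetric for
every `x ≠ 0` — at points where `V ≠ 0` by the previous lemma, on open sets where `V ≡ 0`
trivially, and everywhere by continuity of `DV`. [cite: Shvydkoy2018, Prop. 2.1] -/
theorem fderiv_velocity_symmetric (hx : x ≠ 0) (u w : E) :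
    ⟪fderiv ℝ V x u, w⟫ = ⟪fderiv ℝ V x w, u⟫ := by
  by_contra hne
  set s : E → ℝ := fun y => ⟪fderiv ℝ V y u, w⟫ - ⟪fderiv ℝ V y w, u⟫ with hs
  have hsc : ContinuousOn s {y | y ≠ 0} := by
    have hDV := h.contDiffOn_velocity.continuousOn_fderiv_of_isOpen isOpen_ne le_rfl
    exact ((hDV.clm_apply continuousOn_const).inner continuousOn_const).sub
      ((hDV.clm_apply continuousOn_const).inner continuousOn_const)
  have hsx : s x ≠ 0 := sub_ne_zero.mpr hne
  have hN : ∀ᶠ y in 𝓝 x, s y ≠ 0 ∧ y ≠ 0 :=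
    ((hsc.continuousAt (isOpen_ne.mem_nhds hx)).eventually_ne hsx).and
      (isOpen_ne.eventually_mem hx)
  by_cases hV0 : ∀ᶠ y in 𝓝 x, V y = 0
  · have hD : fderiv ℝ V x = 0 := by
      rw [Filter.EventuallyEq.fderiv_eq (hV0 : V =ᶠ[𝓝 x] fun _ => 0)]
      simp
    apply hsx
    simp [hs, hD]
  · have hfr : ∃ᶠ y in 𝓝 x, V y ≠ 0 := by simpa [Filter.not_eventually] using hV0
    obtain ⟨y, hyV, hsy, hy0⟩ := (hfr.and_eventually hN).exists
    exact hsy (sub_eq_zero.mpr (fderiv_velocity_symmetric_of_ne h h3 hy0 hyV u w))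

end Curl

/-! #### Step 3 of the printed proof: a closed and co-closed field is a gradient, and vanishes -/

omit [FiniteDimensional ℝ E] in
/-- Gluing local primitives: if convex open sets `H i` carry a closed `1`-form `ω`, one of them,
`H i₀`, meets every pairwise intersection `H j ∩ H k` (including `j = k`), then `ω` has a primitive
on `⋃ H i` (Poincaré lemma on each `H i`, Mathlib's
`Convex.exists_forall_hasFDerivAt_of_fderiv_symmetric`, constants adjusted along `H i₀`).
[folklore] -/
theorem exists_primitive_of_cover {ι : Type*} (H : ι → Set E) (hHo : ∀ i, IsOpen (H i))
    (hHc : ∀ i, Convex ℝ (H i)) (i₀ : ι) (hn : ∀ j k, (H i₀ ∩ H j ∩ H k).Nonempty)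
    {ω : E → E →L[ℝ] ℝ} (hω : ∀ i, DifferentiableOn ℝ ω (H i))
    (hsymm : ∀ i, ∀ a ∈ H i, ∀ u v, fderiv ℝ ω a u v = fderiv ℝ ω a v u) :
    ∃ Φ : E → ℝ, ∀ i, ∀ a ∈ H i, HasFDerivAt Φ (ω a) a := by
  classical
  choose φ hφ using fun i =>
    (hHc i).exists_forall_hasFDerivAt_of_fderiv_symmetric (hHo i) (hω i) (hsymm i)
  choose q hq using hn
  set ψ : ι → E → ℝ := fun j x => φ j x + (φ i₀ (q j j) - φ j (q j j)) with hψ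
  have hψd : ∀ j, ∀ a ∈ H j, HasFDerivAt (ψ j) (ω a) a := fun j a ha => (hφ j a ha).add_const _
  have hdiff : ∀ j, DifferentiableOn ℝ (ψ j) (H j) := fun j a ha =>
    (hψd j a ha).differentiableAt.differentiableWithinAt
  have hfd : ∀ j, ∀ a ∈ H j, fderiv ℝ (ψ j) a = ω a := fun j a ha => (hψd j a ha).fderiv
  have h0 : ∀ j, EqOn (ψ i₀) (ψ j) (H i₀ ∩ H j) := by
    intro j
    have hq' := hq j j
    apply ((hHo i₀).inter (hHo j)).eqOn_of_fderiv_eq ((hHc i₀).inter (hHc j)).isPreconnected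
      ((hdiff i₀).mono inter_subset_left) ((hdiff j).mono inter_subset_right)
      (fun a ha => by rw [hfd i₀ a ha.1, hfd j a ha.2]) ⟨hq'.1.1, hq'.1.2⟩
    simp [hψ]
  have hjk : ∀ j k, EqOn (ψ j) (ψ k) (H j ∩ H k) := by
    intro j k
    have hq' := hq j k
    apply ((hHo j).inter (hHo k)).eqOn_of_fderiv_eq ((hHc j).inter (hHc k)).isPreconnected
      ((hdiff j).mono inter_subset_left) ((hdiff k).mono inter_subset_right)
      (fun a ha => by rw [hfd j a ha.1, hfd k a ha.2]) ⟨hq'.1.2, hq'.2⟩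
    rw [← h0 j ⟨hq'.1.1, hq'.1.2⟩, ← h0 k ⟨hq'.1.1, hq'.2⟩]
  refine ⟨fun x => if hx : ∃ i, x ∈ H i then ψ hx.choose x else 0, fun i a ha => ?_⟩
  have heq : (fun x => if hx : ∃ i, x ∈ H i then ψ hx.choose x else 0) =ᶠ[𝓝 a] ψ i := by
    filter_upwards [(hHo i).mem_nhds ha] with y hy
    have hy' : ∃ i, y ∈ H i := ⟨i, hy⟩
    rw [dif_pos hy']
    exact hjk _ i ⟨hy'.choose_spec, hy⟩
  exact (hψd i a ha).congr_of_eventuallyEq heq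

omit [FiniteDimensional ℝ E] in
/-- Open half-spaces are open. [folklore] -/
theorem isOpen_halfSpace (u : E) : IsOpen {x : E | 0 < ⟪u, x⟫} :=
  isOpen_lt continuous_const (continuous_const.inner continuous_id)

omit [FiniteDimensional ℝ E] in
/-- Open half-spaces are convex. [folklore] -/
theorem convex_halfSpace' (u : E) : Convex ℝ {x : E | 0 < ⟪u, x⟫} :=
  convex_halfSpace_gt (innerₗ E u).isLinear 0

omit [FiniteDimensional ℝ E] in
/-- An open half-space through the origin misses the origin. [folklore] -/
theorem ne_zero_of_inner_pos {u x : E} (hx : 0 < ⟪u, x⟫) : x ≠ 0 := by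
  rintro rfl
  simp at hx

omit [FiniteDimensional ℝ E] in
/-- **A good cover of `E ∖ {0}` in dimension `3`.** The four "tetrahedral" directions
`u_(s,t) = ±b₀ ± b₁ ± b₂` (signs `s, t, st`) of an orthonormal basis `b` have Gram matrix `3` on
the diagonal and `-1` off it; the open half-spaces `{⟪u_i, ·⟫ > 0}` cover `E ∖ {0}`, and
`u_(tt) + u_j + u_k` lies in `H_(tt) ∩ H_j ∩ H_k` for all `j, k`. [folklore] -/
theorem exists_tetrahedral_cover (b : OrthonormalBasis (Fin 3) ℝ E) :
    ∃ u : Bool × Bool → E, (∀ x : E, x ≠ 0 → ∃ i, 0 < ⟪u i, x⟫) ∧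
      ∀ j k, ({x : E | 0 < ⟪u (true, true), x⟫} ∩ {x | 0 < ⟪u j, x⟫} ∩
        {x | 0 < ⟪u k, x⟫}).Nonempty := by
  let s : Bool → ℝ := fun t => bif t then 1 else -1
  set u : Bool × Bool → E := fun i => s i.1 • b 0 + s i.2 • b 1 + (s i.1 * s i.2) • b 2 with hu
  have hleft : ∀ i x, ⟪u i, x⟫ = s i.1 * ⟪b 0, x⟫ + s i.2 * ⟪b 1, x⟫ +
      s i.1 * s i.2 * ⟪b 2, x⟫ := fun i x => by
    simp only [hu, inner_add_left, real_inner_smul_left]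
  have n0 : ⟪b 0, b 0⟫ = (1 : ℝ) := by rw [real_inner_self_eq_norm_sq, b.orthonormal.1]; norm_num
  have n1 : ⟪b 1, b 1⟫ = (1 : ℝ) := by rw [real_inner_self_eq_norm_sq, b.orthonormal.1]; norm_num
  have n2 : ⟪b 2, b 2⟫ = (1 : ℝ) := by rw [real_inner_self_eq_norm_sq, b.orthonormal.1]; norm_num
  have o01 : ⟪b 0, b 1⟫ = (0 : ℝ) := b.orthonormal.2 (by decide)
  have o02 : ⟪b 0, b 2⟫ = (0 : ℝ) := b.orthonormal.2 (by decide)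
  have o10 : ⟪b 1, b 0⟫ = (0 : ℝ) := b.orthonormal.2 (by decide)
  have o12 : ⟪b 1, b 2⟫ = (0 : ℝ) := b.orthonormal.2 (by decide)
  have o20 : ⟪b 2, b 0⟫ = (0 : ℝ) := b.orthonormal.2 (by decide)
  have o21 : ⟪b 2, b 1⟫ = (0 : ℝ) := b.orthonormal.2 (by decide)
  -- Gram matrix
  have hgram : ∀ i j, ⟪u i, u j⟫ =
      s i.1 * s j.1 + s i.2 * s j.2 + (s i.1 * s i.2) * (s j.1 * s j.2) := fun i j => by
    rw [hleft]
    simp only [hu, inner_add_right, real_inner_smul_right, n0, n1, n2, o01, o02, o10, o12,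
      o20, o21]
    ring
  have hself : ∀ i, ⟪u i, u i⟫ = 3 := by
    rintro ⟨i1, i2⟩
    rw [hgram]
    cases i1 <;> cases i2 <;> norm_num [s]
  have hge : ∀ i j, (-1 : ℝ) ≤ ⟪u i, u j⟫ := by
    rintro ⟨i1, i2⟩ ⟨j1, j2⟩
    rw [hgram]
    cases i1 <;> cases i2 <;> cases j1 <;> cases j2 <;> norm_num [s]
  refine ⟨u, fun x hx => ?_, fun j k => ?_⟩
  · -- the half-spaces cover `E ∖ {0}`
    by_contra hcon
    push Not at hcon
    have h1 := hcon (true, true)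
    have h2 := hcon (true, false)
    have h4 := hcon (false, true)
    have h5 := hcon (false, false)
    simp only [hleft, s, cond_true, cond_false] at h1 h2 h4 h5
    have e0 : ⟪b 0, x⟫ = 0 := by linarith
    have e1 : ⟪b 1, x⟫ = 0 := by linarith
    have e2 : ⟪b 2, x⟫ = 0 := by linarith
    apply hx
    rw [← b.sum_repr' x, Fin.sum_univ_three, e0, e1, e2]
    simp
  · -- the nerve condition
    refine ⟨u (true, true) + u j + u k, ⟨?_, ?_⟩, ?_⟩ <;>
      simp only [mem_setOf_eq, inner_add_right]
    · have := hge (true, true) j; have := hge (true, true) k; rw [hself]; linarith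
    · have := hge j (true, true); have := hge j k; rw [hself]; linarith
    · have := hge k (true, true); have := hge k j; rw [hself]; linarith

section Final

variable (h : IsHomogeneousSteadyEuler 1 V P) (h3 : finrank ℝ E = 3)
include h h3

/-- **Step 3 of Shvydkoy's proof of Prop. 2.1, first half** (`H¹_dR(S²) = 0`): the closed
`1`-form `⟪V, ·⟫` on `E ∖ {0}` has a global primitive `Φ`. [cite: Shvydkoy2018, Prop. 2.1] -/
theorem exists_primitive_velocity : ∃ Φ : E → ℝ, ∀ y ≠ 0, HasFDerivAt Φ (innerSL ℝ (V y)) y := by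
  set b : OrthonormalBasis (Fin 3) ℝ E := (stdOrthonormalBasis ℝ E).reindex (finCongr h3)
  obtain ⟨u, hcov, hnerve⟩ := exists_tetrahedral_cover b
  set ω : E → E →L[ℝ] ℝ := fun y => innerSL ℝ (V y) with hω
  have hωd : ∀ y ≠ 0,
      HasFDerivAt ω ((innerSL ℝ : E →L[ℝ] E →L[ℝ] ℝ).comp (fderiv ℝ V y)) y := fun y hy =>
    (innerSL ℝ : E →L[ℝ] E →L[ℝ] ℝ).hasFDerivAt.comp y (h.differentiableAt_velocity hy).hasFDerivAt
  have hωD : ∀ i, DifferentiableOn ℝ ω {x : E | 0 < ⟪u i, x⟫} := fun i y hy =>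
    (hωd y (ne_zero_of_inner_pos hy)).differentiableAt.differentiableWithinAt
  have hsymm : ∀ i, ∀ a ∈ {x : E | 0 < ⟪u i, x⟫}, ∀ v w,
      fderiv ℝ ω a v w = fderiv ℝ ω a w v := by
    intro i a ha v w
    rw [(hωd a (ne_zero_of_inner_pos ha)).fderiv]
    simp only [ContinuousLinearMap.comp_apply, innerSL_apply_apply]
    exact fderiv_velocity_symmetric h h3 (ne_zero_of_inner_pos ha) v w
  obtain ⟨Φ, hΦ⟩ := exists_primitive_of_cover (fun i => {x : E | 0 < ⟪u i, x⟫})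
    (fun i => isOpen_halfSpace _) (fun i => convex_halfSpace' _) (true, true) hnerve hωD hsymm
  refine ⟨Φ, fun y hy => ?_⟩
  obtain ⟨i, hi⟩ := hcov y hy
  exact hΦ i y hi

/-- **Step 3 of Shvydkoy's proof of Prop. 2.1, second half** (a harmonic function on `S²` is
constant): the energy identity `∫ ψ ‖V‖² = ∫ ψ ⟪∇Φ, V⟫ = -∫ Φ div (ψ V) = 0`.
[cite: Shvydkoy2018, Prop. 2.1] -/
theorem integral_cutoff_mul_norm_sq [MeasurableSpace E] [BorelSpace E] (μ : Measure E)
    [μ.IsAddHaarMeasure] {ψ : E → ℝ} (hψ : ContDiff ℝ 1 ψ) (hψc : HasCompactSupport ψ)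
    (hψ0 : ψ =ᶠ[𝓝 0] 0) (hψr : ∀ x w, ⟪x, w⟫ = 0 → fderiv ℝ ψ x w = 0) :
    ∫ x, ψ x * ‖V x‖ ^ 2 ∂μ = 0 := by
  obtain ⟨Φ, hΦ⟩ := exists_primitive_velocity h h3
  set W : E → E := fun x => ψ x • V x with hW
  have hWreg : ContDiffOn ℝ 1 W {x | x ≠ 0} := hψ.contDiffOn.smul h.contDiffOn_velocity
  have hW0 : W =ᶠ[𝓝 0] 0 := hψ0.mono fun x hx => by
    simp only [hW, Pi.zero_apply] at hx ⊢
    simp [hx]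
  have hWc : HasCompactSupport W := hψc.smul_right
  have hΦdiff : DifferentiableOn ℝ Φ {x | x ≠ 0} := fun y hy =>
    (hΦ y hy).differentiableAt.differentiableWithinAt
  have hΦreg : ContDiffOn ℝ 1 Φ {x | x ≠ 0} := by
    rw [show (1 : WithTop ℕ∞) = 0 + 1 from (zero_add 1).symm,
      contDiffOn_succ_iff_fderiv_of_isOpen isOpen_ne]
    refine ⟨hΦdiff, fun h0 => absurd h0 (by simp), contDiffOn_zero.mpr ?_⟩
    have hc : ContinuousOn (fun y => innerSL ℝ (V y) : E → E →L[ℝ] ℝ) {x | x ≠ 0} :=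
      (innerSL ℝ : E →L[ℝ] E →L[ℝ] ℝ).continuous.comp_continuousOn
        h.contDiffOn_velocity.continuousOn
    exact hc.congr fun y hy => (hΦ y hy).fderiv
  have key := integral_fderiv_apply_add_mul_divergence_eq_zero μ hWreg hW0 hWc hΦreg
  have hpt : ∀ x, fderiv ℝ Φ x (W x) + Φ x * VectorCalculus.divergence W x = ψ x * ‖V x‖ ^ 2 := by
    intro x
    rcases eq_or_ne x 0 with rfl | hx
    · have hc0 : ψ (0 : E) = 0 := hψ0.eq_of_nhds
      have hDW0 : fderiv ℝ W 0 = 0 := by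
        rw [hW0.fderiv_eq]; simp
      have hW00 : W 0 = 0 := by simp [hW, hc0]
      simp [hW00, hc0, VectorCalculus.divergence, hDW0]
    have hcd : DifferentiableAt ℝ ψ x := hψ.differentiable one_ne_zero x
    have hF : ⟪x, V x⟫ = 0 := by
      rw [real_inner_comm]; exact (normalPart_eq_zero_and_sphBernoulli_eq_zero h h3 hx).1
    rw [hW, divergence_smul_apply (stdOrthonormalBasis ℝ E) hcd (h.differentiableAt_velocity hx),
      h.divergence_eq_zero hx, hψr x _ hF, (hΦ x hx).fderiv, map_smul]
    simp [innerSL_apply_apply]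
  simp_rw [hpt] at key
  exact key

/-- **Shvydkoy 2018, Prop. 2.1, in a `3`-dimensional inner product space**: a `C¹` homogeneous
stationary Euler pair at `α = 1` has `V ≡ 0` off the origin. [cite: Shvydkoy2018, Prop. 2.1] -/
theorem velocity_eq_zero ⦃x : E⦄ (hx : x ≠ 0) : V x = 0 := by
  letI : MeasurableSpace E := borel E
  haveI : BorelSpace E := ⟨rfl⟩
  let μ : Measure E := (stdOrthonormalBasis ℝ E).toBasis.addHaar
  obtain ⟨ψ, hψ, hψnn, hψc, hψ0, hψ1, hψr⟩ := exists_radial_cutoff (E := E)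
  set g : E → ℝ := fun x => ψ x * ‖V x‖ ^ 2 with hg
  have hint : ∫ x, g x ∂μ = 0 := integral_cutoff_mul_norm_sq h h3 μ hψ hψc hψ0 hψr
  have hcont : Continuous g := by
    refine continuous_of_off_origin (hψ.continuous.continuousOn.mul
      ((h.contDiffOn_velocity.continuousOn.norm).pow 2)) ?_
    filter_upwards [hψ0] with y hy
    simp [hg, hy]
  have hnn : 0 ≤ g := fun y => by
    simp only [hg, Pi.zero_apply]
    have := hψnn y
    positivity
  have hgc : HasCompactSupport g := hψc.mul_right
  have hae : g =ᵐ[μ] 0 :=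
    (integral_eq_zero_iff_of_nonneg hnn (hcont.integrable_of_hasCompactSupport hgc)).mp hint
  have hzero : g = 0 := (Continuous.ae_eq_iff_eq μ hcont continuous_const).mp hae
  set c : ℝ := 2 * ‖x‖⁻¹ with hc
  have hxn : 0 < ‖x‖ := norm_pos_iff.mpr hx
  have hcpos : 0 < c := by positivity
  have hy : ‖c • x‖ ^ 2 = 4 := by
    rw [norm_smul, Real.norm_eq_abs, abs_of_pos hcpos, hc]
    field_simp
    norm_num
  have hgy := congr_fun hzero (c • x)
  simp only [hg, Pi.zero_apply, hψ1 _ hy, one_mul, h.velocity_smul_of_alpha_one hcpos hx,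
    norm_smul, mul_pow] at hgy
  have hne : ‖c⁻¹‖ ^ 2 ≠ 0 := by
    rw [Real.norm_eq_abs, abs_of_pos (inv_pos.mpr hcpos)]
    positivity
  have hV : ‖V x‖ ^ 2 = 0 := (mul_eq_zero.mp hgy).resolve_left hne
  exact norm_eq_zero.mp (pow_eq_zero_iff two_ne_zero |>.mp hV)

end Final

end Shvydkoy2018

/-- **Discharge of Shvydkoy 2018, Prop. 2.1** (`shvydkoy_homogeneousSteadyEuler_alpha_one`):
there is no non-trivial `C¹` homogeneous stationary Euler flow on `ℝ³ ∖ {0}` with the Landau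
scaling `α = 1`. The proof follows the printed one (Trans. AMS 370 (2018), Prop. 2.1, p. 2521 =
arXiv:1510.03378, p. 5) step by step, in bulk variables: (1) the integral identity
`-∫ H² = ⅓ ∫ f⁴` (here `Shvydkoy2018.integral_identity`, one integration by parts of
`div (G ψ T)` against a radial cutoff) gives `H = f = 0`; (2) `ω v^⊥ = 0` and continuity give
`dv = 0` (`Shvydkoy2018.fderiv_velocity_symmetric`); (3) `H¹_dR(S²) = 0` (Poincaré lemma on four
convex charts, `Shvydkoy2018.exists_primitive_velocity`) and the energy identity
(`Shvydkoy2018.integral_cutoff_mul_norm_sq`) give `v = 0`. [cite: Shvydkoy2018, Prop. 2.1] -/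
theorem shvydkoy_homogeneousSteadyEuler_alpha_one_holds :
    shvydkoy_homogeneousSteadyEuler_alpha_one := fun _ _ hVP _ hx =>
  Shvydkoy2018.velocity_eq_zero hVP finrank_euclideanSpace_fin hx

end Literature.Analysis.FluidPDE
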